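import Summits.BirchSwinnertonDyer.BirchSwinnertonDyer.Theorems.RamifiedSevenEllipticUnitsBottomLocalIndexSplitReading
import Literature.NumberTheory.EllipticCurves.IwasawaDualModule
import HarnessLib

set_option linter.dupNamespace false
set_option autoImplicit false

/-!
# Route `RamifiedSevenEllipticUnits` (rung K7r), Value crux `EllipticUnitValueSeven`
# (stmt-BirchSwinnertonDyer-19705), line `rubin-formula`, stub S_B4 `stub_bottomLocalIndexSplitSeven`:
# the compact-Selmer PLUMBING the index calculus `λ₀ = c + m_loc` runs on (§2 of two; `--supports 19705`;
# PROVED, nothing asserted, no named fact)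

Cell `bsd-cm`, seat `bsd-cm-k7r-c4` g5 (BRIEF-k7r-split, planner g18; parallel hand with seat k7r-c2 g4,
whose `…BottomLocalIndexSplitReading/Inputs.lean` name the inputs (α), (i)–(iv) of S_B4 — this file
DISCHARGES (iii) `E(K) ⊗ ℤ_p ≤ S_{p,rel}(E/K)` and the `End_K`-stability behind (ii)). HONEST FRAMING:
nothing here closes the stub, the crux, the leaf or any item; BSD is not proved. This file is the plumbing over the
tree's compact Selmer currency (`HeegnerModuleIndex.lean`, `LocalBottomIndex.lean`,
`AnticyclotomicEllipticUnitClass.lean`); its sibling `RamifiedSevenEllipticUnitsBottomLocalIndexSplitAlgebra.lean`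
is the abstract index calculus; the companion file
`RamifiedSevenEllipticUnitsBottomLocalIndexSplit.lean` instantiates both on the carriers of S_B4.

## §2 Plumbing (any field `K`, `V : WeierstrassCurve K`; number field where Selmer groups occur)

`pow_smul_torsionH1Over_eq_zero` (`p^k` kills `H¹(H, E[p^k])`), `padicPi_apply/_add/_zero` (so that `c ↦ c·x` is additive: the `ℤ_p`-lines of the carrier audit),
`reduceTorsionH1_padicPi_apply`,
`conjH1_kummerClassOver` (`conj_σ δ(Q) = δ(σQ)`), `localResTorsionOverOfEmb_kummerClassOver` (with seat k7r-c2's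
`LocalIndexSplitReading.torsionToPointsH1_kummerClassOver`, p-landed 18:43Z: a local Kummer class is a coboundary),
**`kummerClassOver_mem_selmerTorsionOver`** (Kummer ⇒ Selmer), `mem_compactSelmerOver_of_isKummerFamilyOver`,
`padicPi_mem_compactSelmerOver` (`S_p(E/L)` is a `ℤ_p`-module), **`mordellWeilKummerSpan_le_compactSelmerOver`**
(`E(L) ⊗ ℤ_p ⊆ S_p(E/L)`, Howard 2004 §1 / Perrin-Riou 1987 §0), `endH1_kummerClassOver` (`φ_* δ(Q) = δ(φQ)`),
`endPi_padicPi`, `isKummerFamilyOver_endPi`, `endPi_mem_mordellWeilKummerSpan` (`E(L) ⊗ ℤ_p` is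
`End_K(E)`-stable), `endSpan_le_mordellWeilKummerSpan`.

References: Silverman, *AEC* VIII.§2 (Kummer sequence), X.§4; Perrin-Riou, Bull. SMF 115 (1987) §0
(`S_p(L)`); Howard, Compositio 140 (2004) §1 (descent sequence); Serre, *Local Fields* VII.§5 /
*Galois Cohomology* I.§2.5 (conjugation on cohomology); cell memo MEMO-k7r-c4-g5-CARRIER.md.
-/

noncomputable section

open scoped Classical

open NumberField IsDedekindDomain Field
  Literature.NumberTheory.EllipticCurves Literature.NumberTheory.GaloisRepresentations

universe u

namespace Summit.BirchSwinnertonDyer.BirchSwinnertonDyer.Theorems.RamifiedSevenEllipticUnits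

namespace BottomLocalIndexSplit

/-! ## §2 Plumbing over the tree's compact Selmer currency -/

section Torsion

open WeierstrassCurve

variable {K : Type u} [Field K] (V : WeierstrassCurve K)

/-- **`p^k` kills `H¹(H, E[p^k])`** (every class is represented by a cocycle with values in the
`p^k`-torsion `E[p^k]`). [cite: SilvermanAEC2009, VIII.§2 (cohomology of the finite module `E[m]`)] -/
theorem pow_smul_torsionH1Over_eq_zero (p k : ℕ) (H : Subgroup (Field.absoluteGaloisGroup K))
    (x : V.torsionH1Over ((p : ℤ) ^ k) H) : (p ^ k) • x = 0 := by
  obtain ⟨φ, rfl⟩ := oneCocycleClass_surjective (discreteTopRep H (geomTorsion V ((p : ℤ) ^ k))) x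
  refine nsmul_oneCocycleClass_eq_zero φ (p ^ k) fun g ↦ Subtype.ext ?_
  rw [AddSubmonoidClass.coe_nsmul, ← natCast_zsmul, Nat.cast_pow]
  exact (mem_geomTorsion_iff V _ _).1 (φ.1 g).2

variable (p : ℕ) [Fact p.Prime] (H : Subgroup (Field.absoluteGaloisGroup K))

/-- Unfolding the tree's `padicPi` at a level, through `ℕ`-multiples: `(c·x)_k = (c mod p^k)·x_k`.
[cite: PerrinRiou1987BSMF, §0 p. 401 (the `ℤ_p`-module structure of `S_p(L)`)] -/
theorem padicPi_apply (c : ℤ_[p]) (x : V.torsionH1Pi p H) (k : ℕ) :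
    V.padicPi p H c x k = (PadicInt.toZModPow k c).val • x k := by
  simp only [padicPi, AddMonoidHom.pi_apply, AddMonoidHom.coe_comp, Function.comp_apply,
    Pi.evalAddMonoidHom_apply, zsmulAddGroupHom_apply, natCast_zsmul]

/-- `padicPi` is additive in the scalar: `(c + c')·x = c·x + c'·x`. [cite: PerrinRiou1987BSMF, §0 p. 401 (the `ℤ_p`-module structure of `S_p(L)`)] -/
theorem padicPi_add (c c' : ℤ_[p]) (x : V.torsionH1Pi p H) :
    V.padicPi p H (c + c') x = V.padicPi p H c x + V.padicPi p H c' x := by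
  funext k
  rw [Pi.add_apply, padicPi_apply, padicPi_apply, padicPi_apply, map_add, ZMod.val_add,
    Literature.NumberTheory.EllipticCurves.IwasawaDual.mod_smul_eq (pow_smul_torsionH1Over_eq_zero V p k H (x k)), add_smul]

/-- `0·x = 0`. [cite: PerrinRiou1987BSMF, §0 p. 401 (the `ℤ_p`-module structure of `S_p(L)`)] -/
theorem padicPi_zero (x : V.torsionH1Pi p H) : V.padicPi p H 0 x = 0 := by
  funext k
  rw [padicPi_apply, map_zero, ZMod.val_zero, zero_smul, Pi.zero_apply]

/-- `padicPi c` preserves `p`-compatibility at a level (the residues of `c` are compatible and `p^k`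
kills level `k`). [cite: PerrinRiou1987BSMF, §0 p. 401 (`S_p(L)` is a `ℤ_p`-module)] -/
theorem reduceTorsionH1_padicPi_apply (c : ℤ_[p]) (x : V.torsionH1Pi p H) (k : ℕ)
    (hx : V.reduceTorsionH1 p k H (x (k + 1)) = x k) :
    V.reduceTorsionH1 p k H (V.padicPi p H c x (k + 1)) = V.padicPi p H c x k := by
  rw [padicPi_apply, padicPi_apply, map_nsmul, hx]
  have hval : (PadicInt.toZModPow k c).val = (PadicInt.toZModPow (k + 1) c).val % p ^ k := by
    rw [← PadicInt.zmod_cast_comp_toZModPow k (k + 1) (Nat.le_succ k), RingHom.comp_apply,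
      ZMod.castHom_apply, ZMod.cast_eq_val, ZMod.val_natCast]
  rw [hval, Literature.NumberTheory.EllipticCurves.IwasawaDual.mod_smul_eq (pow_smul_torsionH1Over_eq_zero V p k H (x k))]

end Torsion

section Kummer

open WeierstrassCurve

variable {K : Type u} [Field K] (V : WeierstrassCurve K)

/-- **Conjugation of a Kummer class is the Kummer class of the conjugated root**:
`conj_σ δ(m•Q) = δ(m•σQ)` in `H¹(H, E[m])` (`H` normal; on cocycles `σ•((σ⁻¹τσ)Q − Q) = τ(σQ) − σQ`).
[cite: SerreLocalFields1979, VII.§5 (conjugation on cohomology)] [cite: SilvermanAEC2009, VIII.§2 (the Kummer cocycle)] -/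
theorem conjH1_kummerClassOver (H : Subgroup (Field.absoluteGaloisGroup K)) [H.Normal] (m : ℤ)
    (σ : Field.absoluteGaloisGroup K) (Q : geomPoints V) (hQ : ∀ τ ∈ H, τ • (m • Q) = m • Q) :
    Literature.NumberTheory.EllipticCurves.conjH1 H (geomTorsion V m) σ (V.kummerClassOver H m Q hQ) =
      V.kummerClassOver H m (σ • Q) (fun τ hτ ↦ by
        rw [← smul_zsmul_geomPoints, ← mul_smul,
          show τ * σ = σ * (σ⁻¹ * τ * σ) by group, mul_smul,
          hQ _ (conj_mem_of_normal H σ ⟨τ, hτ⟩), smul_zsmul_geomPoints]) := by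
  rw [Literature.NumberTheory.EllipticCurves.conjH1, kummerClassOver, kummerClassOver]
  refine (map_oneCocycleClass (X := discreteTopRep H (geomTorsion V m))
    (Y := discreteTopRep H (geomTorsion V m)) (subgroupConj H σ) (resHomOfEquivariant _ _ _)
    (V.kummerCocycleOver H m Q hQ)).trans ?_
  congr 1
  refine Subtype.ext (ContinuousMap.ext fun τ ↦ Subtype.ext ?_)
  change σ • ((σ⁻¹ * (τ : Field.absoluteGaloisGroup K) * σ) • Q - Q) =
    (τ : Field.absoluteGaloisGroup K) • σ • Q - σ • Q
  rw [smul_sub, ← mul_smul, show σ * (σ⁻¹ * (τ : Field.absoluteGaloisGroup K) * σ) = τ * σ by group,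
    mul_smul]

variable {E : Type u} [Field E] [Algebra K E] (ι : AlgebraicClosure K →ₐ[K] AlgebraicClosure E)

/-- **The local restriction (points coefficients) of a global Kummer class vanishes**: the Kummer
condition at the place singled out by `ι` holds for `δ(m•Q)` (`localResTorsionOverOfEmb_eq_comp`,
`localTorsionResOfEmb_kummerClassOver`, and seat k7r-c2's `LocalIndexSplitReading.torsionToPointsH1_kummerClassOver`).
[cite: SilvermanAEC2009, X.§4 (Remark 4.1.1: the local image of the Kummer map)] -/
theorem localResTorsionOverOfEmb_kummerClassOver (m : ℤ) (H : Subgroup (Field.absoluteGaloisGroup K))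
    (Q : geomPoints V) (hQ : ∀ τ ∈ H, τ • (m • Q) = m • Q) :
    V.localResTorsionOverOfEmb m H ι (V.kummerClassOver H m Q hQ) = 0 := by
  rw [localResTorsionOverOfEmb_eq_comp, AddMonoidHom.comp_apply, localTorsionResOfEmb_kummerClassOver,
    LocalIndexSplitReading.torsionToPointsH1_kummerClassOver]

/-- **An endomorphism applied to a Kummer class**: `φ_* δ(m•Q) = δ(m•φQ)` for `φ ∈ End_K(E)`
(`φ` is additive and commutes with `Γ_K`). [cite: SilvermanAEC2009, III.4 (End_K(E)) and VIII.§2 (functoriality of the Kummer map)] -/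
theorem endH1_kummerClassOver (H : Subgroup (Field.absoluteGaloisGroup K))
    {φ : AddMonoid.End V.geomPoints} (hφ : φ ∈ V.endRing) (m : ℤ)
    (Q : geomPoints V) (hQ : ∀ τ ∈ H, τ • (m • Q) = m • Q) :
    V.endH1 hφ m H (V.kummerClassOver H m Q hQ) =
      V.kummerClassOver H m (φ Q) (fun σ hσ ↦ by rw [← map_zsmul, ← hφ.2, hQ σ hσ]) := by
  rw [endH1, kummerClassOver, kummerClassOver]
  refine (map_oneCocycleClass (X := discreteTopRep H (geomTorsion V m))
    (Y := discreteTopRep H (geomTorsion V m)) (ContinuousMonoidHom.id H) (resHomOfEquivariant _ _ _)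
    (V.kummerCocycleOver H m Q hQ)).trans ?_
  congr 1
  refine Subtype.ext (ContinuousMap.ext fun τ ↦ Subtype.ext ?_)
  change φ ((τ : Field.absoluteGaloisGroup K) • Q - Q) = (τ : Field.absoluteGaloisGroup K) • φ Q - φ Q
  rw [map_sub, hφ.2]

variable (p : ℕ) [Fact p.Prime] (H : Subgroup (Field.absoluteGaloisGroup K))

/-- **Endomorphisms commute with the `ℤ_p`-action** on `∏_k H¹(H, E[p^k])` (both are componentwise
additive). [cite: PerrinRiou1987BSMF, §0 p. 401 (the `ℤ_p`-module structure of `S_p(L)`)] -/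
theorem endPi_padicPi {φ : AddMonoid.End V.geomPoints} (hφ : φ ∈ V.endRing) (c : ℤ_[p])
    (x : V.torsionH1Pi p H) : V.endPi hφ p H (V.padicPi p H c x) = V.padicPi p H c (V.endPi hφ p H x) := by
  funext k
  simp only [endPi, AddMonoidHom.pi_apply, AddMonoidHom.coe_comp, Function.comp_apply,
    Pi.evalAddMonoidHom_apply, padicPi_apply, map_nsmul]

/-- **An endomorphism maps the Kummer family of `P` to the Kummer family of `φ P`.**
[cite: Howard2004HeegnerKolyvagin, §1 (the compact Kummer map `E(L) ⊗ ℤ_p → S_p(E/L)`)] [cite: SilvermanAEC2009, III.4 and VIII.§2] -/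
theorem isKummerFamilyOver_endPi [V.IsElliptic] {φ : AddMonoid.End V.geomPoints} (hφ : φ ∈ V.endRing)
    {P : geomPoints V} (hP : ∀ σ ∈ H, σ • P = P) {d : V.torsionH1Pi p H}
    (hd : V.IsKummerFamilyOver p H hP d) :
    V.IsKummerFamilyOver p H (P := φ P) (fun σ hσ ↦ by rw [← hφ.2, hP σ hσ]) (V.endPi hφ p H d) := by
  intro k Q' hQ'
  have hpk : ((p : ℤ) ^ k) ≠ 0 := pow_ne_zero _ (Int.natCast_ne_zero.mpr (Fact.out : p.Prime).ne_zero)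
  obtain ⟨Q, hQ⟩ := V.zsmul_geomPoints_surjective_holds hpk P
  have hQ1 : ((p : ℤ) ^ k) • Q = P := hQ
  change V.endH1 hφ ((p : ℤ) ^ k) H (d k) = _
  rw [hd k Q hQ1, endH1_kummerClassOver]
  exact V.kummerClassOver_eq_of_zsmul_eq H _ _ _ _ _ (by rw [← map_zsmul, hQ1, hQ'])

/-- **`E(L) ⊗ ℤ_p` (the tree's `mordellWeilKummerSpan`) is stable under `End_K(E)`** (generators to
generators: `φ(c·δ(P)) = c·δ(φP)`, `φP` again `H`-fixed). [cite: Howard2004HeegnerKolyvagin, §1 (the compact Kummer map `E(L) ⊗ ℤ_p → S_p(E/L)`)] -/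
theorem endPi_mem_mordellWeilKummerSpan [V.IsElliptic] {φ : AddMonoid.End V.geomPoints}
    (hφ : φ ∈ V.endRing) {x : V.torsionH1Pi p H} (hx : x ∈ V.mordellWeilKummerSpan p H) :
    V.endPi hφ p H x ∈ V.mordellWeilKummerSpan p H := by
  unfold mordellWeilKummerSpan kummerSpan at hx ⊢
  induction hx using AddSubgroup.closure_induction with
  | mem y hy =>
    obtain ⟨P, hPS, c, d, hd, rfl⟩ := hy
    rw [endPi_padicPi]
    have hPfix : φ P ∈ (V.fixedGeomPoints H : Set (geomPoints V)) :=
      (V.mem_fixedGeomPoints_iff _).2 fun σ hσ ↦ by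
        rw [← hφ.2, (V.mem_fixedGeomPoints_iff P).1 hPS σ hσ]
    exact AddSubgroup.subset_closure
      ⟨φ P, hPfix, c, _, isKummerFamilyOver_endPi V p H hφ _ hd, rfl⟩
  | zero => rw [map_zero]; exact zero_mem _
  | add a b _ _ ha hb => rw [map_add]; exact add_mem ha hb
  | neg a _ ha => rw [map_neg]; exact neg_mem ha

/-- **The `End_K(E)`-span of a Mordell–Weil class is Mordell–Weil**: `x ∈ E(L) ⊗ ℤ_p ⇒ 𝒪·x ⊆ E(L) ⊗ ℤ_p`
(`endSpan` = the additive closure of the `φ·x`). [cite: BurungaleKobayashiNakamuraOta2026, §3.3.1 (arXiv:2608.06879 p. 19) (the module `𝒪·z`; shape only)] -/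
theorem endSpan_le_mordellWeilKummerSpan [V.IsElliptic] {x : V.torsionH1Pi p H}
    (hx : x ∈ V.mordellWeilKummerSpan p H) : V.endSpan p H x ≤ V.mordellWeilKummerSpan p H := by
  unfold endSpan
  rw [AddSubgroup.closure_le]
  rintro y ⟨φ, hφ, rfl⟩
  exact endPi_mem_mordellWeilKummerSpan V p H hφ hx

end Kummer

section Selmer

open WeierstrassCurve

variable {K : Type u} [Field K] [NumberField K] (V : WeierstrassCurve K)

/-- **Kummer classes are Selmer classes**: `δ(m•Q) ∈ Sel^{(m)}(E/L)` for `m•Q ∈ E(L)`, `L = K̄^H`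
(at every place of `L`: conjugate by `σ` = pass to the root `σQ`, then the local restriction vanishes).
[cite: SilvermanAEC2009, X.§4 (Thm. 4.2: `E(K)/mE(K) ↪ Sel^{(m)}(E/K)`)] [cite: PerrinRiou1987BSMF, §0 p. 401] -/
theorem kummerClassOver_mem_selmerTorsionOver (H : Subgroup (Field.absoluteGaloisGroup K)) [H.Normal]
    (m : ℤ) (Q : geomPoints V) (hQ : ∀ τ ∈ H, τ • (m • Q) = m • Q) :
    V.kummerClassOver H m Q hQ ∈ V.selmerTorsionOver H m := by
  simp only [selmerTorsionOver, AddSubgroup.mem_inf, AddSubgroup.mem_iInf, AddSubgroup.mem_comap,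
    AddMonoidHom.mem_ker]
  exact ⟨fun v σ ↦ by rw [conjH1_kummerClassOver, localResTorsionOverOfEmb_kummerClassOver],
    fun w σ ↦ by rw [conjH1_kummerClassOver, localResTorsionOverOfEmb_kummerClassOver]⟩

variable (p : ℕ) [Fact p.Prime] (H : Subgroup (Field.absoluteGaloisGroup K)) [H.Normal]

/-- **Kummer families are compact Selmer elements** (Selmer at every level, `p`-compatible by
`IsKummerFamilyOver.reduceTorsionH1`). [cite: Howard2004HeegnerKolyvagin, §1 (descent sequence `0 → E(L) ⊗ ℤ_p → S_p(E/L) → …`)] -/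
theorem mem_compactSelmerOver_of_isKummerFamilyOver [V.IsElliptic] {P : geomPoints V}
    (hP : ∀ σ ∈ H, σ • P = P) {d : V.torsionH1Pi p H} (hd : V.IsKummerFamilyOver p H hP d) :
    d ∈ V.compactSelmerOver H p := by
  rw [mem_compactSelmerOver_iff]
  refine ⟨fun k ↦ ?_, fun k ↦ IsKummerFamilyOver.reduceTorsionH1 p hd k⟩
  have hpk : ((p : ℤ) ^ k) ≠ 0 := pow_ne_zero _ (Int.natCast_ne_zero.mpr (Fact.out : p.Prime).ne_zero)
  obtain ⟨Q, hQ⟩ := V.zsmul_geomPoints_surjective_holds hpk P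
  rw [hd k Q hQ]
  exact kummerClassOver_mem_selmerTorsionOver V H _ Q _

/-- **`S_p(E/L)` is a `ℤ_p`-submodule** of `∏_k H¹(H, E[p^k])` (levelwise integer multiples;
compatibility by `reduceTorsionH1_padicPi_apply`). [cite: PerrinRiou1987BSMF, §0 p. 401 ("des `ℤ_p`-modules compacts")] -/
theorem padicPi_mem_compactSelmerOver (c : ℤ_[p]) {x : V.torsionH1Pi p H}
    (hx : x ∈ V.compactSelmerOver H p) : V.padicPi p H c x ∈ V.compactSelmerOver H p := by
  rw [mem_compactSelmerOver_iff] at hx ⊢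
  refine ⟨fun k ↦ ?_, fun k ↦ reduceTorsionH1_padicPi_apply V p H c x k (hx.2 k)⟩
  rw [padicPi_apply]
  exact AddSubgroup.nsmul_mem _ (hx.1 k) _

/-- **Kummer spans are compact Selmer**: `kummerSpan S ≤ S_p(E/L)` for any set `S` of `H`-fixed points.
[cite: Howard2004HeegnerKolyvagin, §1 (descent sequence for `S_p(E/L)`)] -/
theorem kummerSpan_le_compactSelmerOver [V.IsElliptic] (S : Set (geomPoints V))
    (hS : ∀ P ∈ S, ∀ σ ∈ H, σ • P = P) : V.kummerSpan p H S hS ≤ V.compactSelmerOver H p := by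
  unfold kummerSpan
  rw [AddSubgroup.closure_le]
  rintro x ⟨P, hPS, c, d, hd, rfl⟩
  exact padicPi_mem_compactSelmerOver V p H c (mem_compactSelmerOver_of_isKummerFamilyOver V p H _ hd)

/-- **`E(L) ⊗ ℤ_p ⊆ S_p(E/L)`**: the Mordell–Weil Kummer span lies in the compact Selmer group — the
first map of Howard's descent sequence `0 → E(L) ⊗ ℤ_p → S_p(E/L) → T_pШ(E/L) → 0` in the tree's
currency. [cite: Howard2004HeegnerKolyvagin, §1 (descent sequence for `S_p(E/L)`)] [cite: PerrinRiou1987BSMF, §0 pp. 401–402] -/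
theorem mordellWeilKummerSpan_le_compactSelmerOver [V.IsElliptic] :
    V.mordellWeilKummerSpan p H ≤ V.compactSelmerOver H p :=
  kummerSpan_le_compactSelmerOver V p H _ _

end Selmer

end BottomLocalIndexSplit

end Summit.BirchSwinnertonDyer.BirchSwinnertonDyer.Theorems.RamifiedSevenEllipticUnits

end
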